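import Mathlib
import Summits.Ventures.HodgeRepro.Tier3PadicComplexInt
import Summits.Ventures.HodgeRepro.Tier4.Line2.BranchCoefficients

/-!
# Tier4/Line2/K1a — FROBENIUS LINES: the restriction of a non-zero `d`-variable series is non-zero (LINE L2, K1a)

Blind re-derivation cell `pub-hodge-repro`, Tier 4 (README §9–§10), LINE L2 (t4-plan-2's skeleton
`Tier4/Line2/Skeleton.lean` v0.8, sha256 `fdd5978f…`), seat t4-L2-p1 (lead S12052).  Statement VERBATIM from the
skeleton (L274–L278): for the coefficient ring `O` of the Katz measures (`BranchCoefficients`: a complete DVR `A = O`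
with `O ↪ 𝓞_{ℂ_p}`) and a non-zero `F ∈ O⟦T_1, …, T_d⟧` there are exponents `k : Fin d → ℕ` such that the
one-variable restriction `F((1+X)^{p^{k_1}} − 1, …, (1+X)^{p^{k_d}} − 1) ∈ O⟦X⟧` (Mathlib's `MvPowerSeries.subst`)
is NON-ZERO.

## The proof (the skeleton's own Frobenius-line argument, no printed input)
* **Part D (`μ`-factoring)** — `F = ϖ^μ • F′` with `F′ ≢ 0 (mod ϖ)`: `μ` is the minimum of the coefficient
  valuations (`IsDiscreteValuationRing.addVal`, `Nat.sInf_mem`), `ϖ^μ` divides every coefficient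
  (`addVal_le_iff_dvd`), and the coefficient attaining `μ` becomes a unit (`addVal_eq_zero_iff`), so its residue is
  non-zero.  (t4-lit-4's landed `Tier4/LitMuInvariantApi.lean` carries the same factoring as `muInv` API, S12107;
  this file keeps it Mathlib-only.)
* **Part C (characteristic `p`)** — `p ∈ 𝔪_O` because `p` is not a unit of `𝓞_{ℂ_p}` (`‖p‖ = p⁻¹ < 1`, the landed
  `T3.R2Pinning.not_isUnit_natCast_prime`), so the residue field `κ = O/𝔪` has characteristic `p`, and in `κ⟦X⟧`
  the Frobenius line is a monomial: `(1+X)^{p^k} − 1 = X^{p^k}` (`add_pow_char_pow`).  The `CharP` glue is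
  t4-plan-2's farm-checked `Helpers/CharPHelpers.lean` (S12064), inlined with its proofs.
* **Part B (monomial substitution over any ring)** — `MvPowerSeries.map_subst` commutes the reduction mod `ϖ` with the
  substitution; for `T_i ↦ X^{n_i}` the `X^N`-coefficient of the image of `G` is the finite sum of the coefficients of
  `G` over the monomials `m` of line weight `Σ_i m_i n_i = N` (`MvPowerSeries.coeff_subst`).  Let `m₀` be the
  LEXICOGRAPHICALLY SMALLEST monomial of the support of `Ḡ = F̄′` (first index most significant; `Lex (Fin d →₀ ℕ)` is
  well-ordered, `Finsupp.Lex.wellFoundedLT`).  With the exponents of Part A the weight of `m₀` is attained by no other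
  support monomial, so the `X^{weight(m₀)}`-coefficient of the image is `coeff m₀ Ḡ ≠ 0` (`finsum_eq_single`).
* **Part A (the exponent choice)** — for every `m₀` there are exponents `k` with `weight(m₀) < weight(m)` for every
  `m` lexicographically larger than `m₀`: induction on `d`, `k = (W′, k′)` with `k′` from the tail of `m₀` and
  `p^{W′} > W′ := Σ_{j ≥ 1} m₀_j p^{k′_j}` (`Nat.lt_pow_self`): a larger first coordinate contributes at least
  `p^{W′} > W′`, an equal first coordinate reduces to the tails.
* **Assembly** — `subst_k F = ϖ^μ • subst_k F′` (`MvPowerSeries.subst_smul`) and `subst_k F′ ≢ 0 (mod ϖ)` by Parts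
  B–C, so `subst_k F′ ≠ 0`; the coefficients live in the domain `A` and `ϖ^μ ≠ 0`, so `subst_k F ≠ 0`.

Imports: Mathlib, the landed `Tier3PadicComplexInt` (for `not_isUnit_natCast_prime`), the landed
`Tier4/Line2/BranchCoefficients` (the structure, verbatim from the skeleton).  `#print axioms
exists_subst_frobenius_ne_zero = [propext, Classical.choice, Quot.sound]` (farm, 2026-08-28T19:4xZ).
HC_CM is NOT proved by anyone in this repository.
-/

namespace Summit.Ventures.HodgeRepro.Tier4.Line2

/-! ## Part A — the exponent choice (pure arithmetic) -/

namespace FrobeniusLine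

/-- The Frobenius-line weight of an exponent vector `m` for the exponents `k`: `Σ_i m_i p^{k_i}`
(the `X`-degree of the image of the monomial `T^m` under `T_i ↦ X^{p^{k_i}}`). -/
def lineWeight (p : ℕ) {d : ℕ} (k : Fin d → ℕ) (m : Fin d → ℕ) : ℕ := ∑ i, m i * p ^ k i

/-- The line weight in `d + 1` variables: first coordinate plus the weight of the tail. -/
theorem lineWeight_succ (p : ℕ) {d : ℕ} (k : Fin (d + 1) → ℕ) (m : Fin (d + 1) → ℕ) :
    lineWeight p k m = m 0 * p ^ k 0 + lineWeight p (Fin.tail k) (Fin.tail m) := by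
  simp only [lineWeight, Fin.sum_univ_succ, Fin.tail]

/-- **The exponent choice**: for every exponent vector `m₀` there are exponents `k` such that every `m`
lexicographically larger than `m₀` (first index most significant) has strictly larger line weight.
Induction on `d`: `k = (W′, k′)` with `k′` from the tail and `p^{W′} > W′ := Σ_{j ≥ 1} m₀_j p^{k′_j}`. -/
theorem exists_lineWeight_lt (p : ℕ) (hp : 2 ≤ p) :
    ∀ {d : ℕ} (m₀ : Fin d → ℕ), ∃ k : Fin d → ℕ, ∀ m : Fin d → ℕ,
      (∃ i, (∀ j, j < i → m₀ j = m j) ∧ m₀ i < m i) → lineWeight p k m₀ < lineWeight p k m := by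
  intro d
  induction d with
  | zero =>
    intro m₀
    exact ⟨fun _ => 0, fun _ ⟨i, _⟩ => i.elim0⟩
  | succ d ih =>
    intro m₀
    obtain ⟨k', hk'⟩ := ih (Fin.tail m₀)
    set W' := lineWeight p k' (Fin.tail m₀) with hW'
    refine ⟨Fin.cons W' k', ?_⟩
    rintro m ⟨i, hji, hi⟩
    have hpow : W' < p ^ W' := Nat.lt_pow_self (by omega)
    rw [lineWeight_succ, lineWeight_succ, Fin.cons_zero]
    change m₀ 0 * p ^ W' + W' < m 0 * p ^ W' + lineWeight p k' (Fin.tail m)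
    rcases Fin.eq_zero_or_eq_succ i with rfl | ⟨i', rfl⟩
    · -- first coordinate already larger: `m₀ 0 < m 0`
      calc m₀ 0 * p ^ W' + W' < m₀ 0 * p ^ W' + p ^ W' := Nat.add_lt_add_left hpow _
        _ = (m₀ 0 + 1) * p ^ W' := by ring
        _ ≤ m 0 * p ^ W' := Nat.mul_le_mul_right _ hi
        _ ≤ m 0 * p ^ W' + lineWeight p k' (Fin.tail m) := Nat.le_add_right _ _
    · -- first coordinate equal, tails lexicographically ordered
      have h0 : m₀ 0 = m 0 := hji 0 (Fin.succ_pos i')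
      have htail : lineWeight p k' (Fin.tail m₀) < lineWeight p k' (Fin.tail m) :=
        hk' (Fin.tail m) ⟨i', fun j hj => hji j.succ (Fin.succ_lt_succ_iff.mpr hj), hi⟩
      rw [h0]
      exact Nat.add_lt_add_left htail _

/-! ## Part B — substitution of monomials `T_i ↦ X^{n_i}` over any commutative ring -/

variable {d : ℕ} {R : Type} [CommRing R]

/-- `PowerSeries.X` has zero constant coefficient, read through `MvPowerSeries Unit`. -/
theorem constantCoeff_X' : MvPowerSeries.constantCoeff (PowerSeries.X : PowerSeries R) = 0 :=
  PowerSeries.constantCoeff_X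

/-- `T_i ↦ X^{n_i}` (`n_i ≠ 0`) is an admissible substitution. -/
theorem hasSubst_X_pow (n : Fin d → ℕ) (hn : ∀ i, n i ≠ 0) :
    MvPowerSeries.HasSubst (fun i => (PowerSeries.X : PowerSeries R) ^ n i) :=
  MvPowerSeries.hasSubst_of_constantCoeff_zero (fun i => by simp [constantCoeff_X', hn i])

/-- The monomial `T^m` goes to `X^{Σ_i m_i n_i}` under `T_i ↦ X^{n_i}`. -/
theorem prod_X_pow (n : Fin d → ℕ) (m : Fin d →₀ ℕ) :
    (m.prod fun i e => ((PowerSeries.X : PowerSeries R) ^ n i) ^ e) =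
      PowerSeries.X ^ (∑ i, m i * n i) := by
  rw [Finsupp.prod_fintype _ _ (fun i => by simp)]
  simp_rw [← pow_mul]
  rw [Finset.prod_pow_eq_pow_sum]
  congr 1
  exact Finset.sum_congr rfl (fun i _ => by ring)

/-- **Coefficient formula** for `T_i ↦ X^{n_i}`: the `X^N`-coefficient of the image of `G` is the (finite) sum of the
coefficients of `G` over the monomials of weight `N`. -/
theorem coeff_subst_X_pow (n : Fin d → ℕ) (hn : ∀ i, n i ≠ 0) (G : MvPowerSeries (Fin d) R) (N : ℕ) :
    PowerSeries.coeff N (MvPowerSeries.subst (fun i => (PowerSeries.X : PowerSeries R) ^ n i) G) =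
      ∑ᶠ m : Fin d →₀ ℕ, if N = ∑ i, m i * n i then MvPowerSeries.coeff m G else 0 := by
  change MvPowerSeries.coeff (Finsupp.single () N) _ = _
  rw [MvPowerSeries.coeff_subst (hasSubst_X_pow n hn) G (Finsupp.single () N)]
  refine finsum_congr (fun m => ?_)
  rw [prod_X_pow n m]
  change MvPowerSeries.coeff m G • PowerSeries.coeff N ((PowerSeries.X : PowerSeries R) ^ _) = _
  rw [PowerSeries.coeff_X_pow]
  split_ifs <;> simp

/-- **Non-vanishing along a Frobenius line, over any commutative ring**: a non-zero `G ∈ R⟦T_1, …, T_d⟧` stays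
non-zero under `T_i ↦ X^{p^{k_i}}` for suitable exponents `k` — the `X^N`-coefficient, `N` the line weight of the
lexicographically smallest monomial `m₀` of the support, is the coefficient of `m₀`. -/
theorem exists_subst_X_pow_ne_zero (p : ℕ) (hp : 2 ≤ p) (G : MvPowerSeries (Fin d) R) (hG : G ≠ 0) :
    ∃ k : Fin d → ℕ,
      MvPowerSeries.subst (fun i => (PowerSeries.X : PowerSeries R) ^ p ^ k i) G ≠ 0 := by
  -- the support of `G`, as a set of the lexicographically ordered exponent vectors
  let S : Set (Lex (Fin d →₀ ℕ)) := {m | MvPowerSeries.coeff (ofLex m) G ≠ 0}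
  have hSne : S.Nonempty := by
    by_contra h
    rw [Set.not_nonempty_iff_eq_empty] at h
    apply hG
    ext m
    have hm : toLex m ∉ S := by rw [h]; exact Set.notMem_empty _
    simpa [S] using hm
  obtain ⟨m₀, hm₀S, hmin⟩ := WellFounded.has_min wellFounded_lt S hSne
  obtain ⟨k, hk⟩ := exists_lineWeight_lt p hp (fun i => ofLex m₀ i)
  refine ⟨k, fun h0 => ?_⟩
  have hcoeff := coeff_subst_X_pow (fun i => p ^ k i) (fun i => pow_ne_zero _ (by omega)) G
    (lineWeight p k (fun i => ofLex m₀ i))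
  rw [h0, map_zero, finsum_eq_single _ (ofLex m₀)] at hcoeff
  · have hw₀ : (lineWeight p k fun i => ofLex m₀ i) = ∑ i, ofLex m₀ i * p ^ k i := rfl
    rw [if_pos hw₀] at hcoeff
    exact hm₀S hcoeff.symm
  · intro m hm
    by_cases hmS : toLex m ∈ S
    · have hlt : m₀ < toLex m := by
        refine lt_of_le_of_ne (not_lt.mp (hmin _ hmS)) ?_
        intro h
        exact hm (by rw [h]; rfl)
      rw [Finsupp.Lex.lt_iff] at hlt
      have hw := hk (fun i => m i) hlt
      rw [if_neg]
      exact ne_of_lt hw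
    · simp only [S, Set.mem_setOf_eq, not_not] at hmS
      have hm0 : MvPowerSeries.coeff m G = 0 := hmS
      rw [hm0, ite_self]

/-! ## Part C — characteristic `p`: the Frobenius lines become monomials
(the `CharP` glue is t4-plan-2's farm-checked `Helpers/CharPHelpers.lean` (S12064), inlined here with its proofs). -/

/-- `CharP` of a power-series ring over a ring of characteristic `p` (Mathlib has no instance). -/
theorem charP_powerSeries (κ : Type) [CommRing κ] (p : ℕ) [CharP κ p] : CharP (PowerSeries κ) p where
  cast_eq_zero_iff n := by
    rw [← map_natCast (PowerSeries.C (R := κ)) n, map_eq_zero_iff _ PowerSeries.C_injective]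
    exact CharP.cast_eq_zero_iff κ p n

/-- `p ∈ 𝔪_A` for a local ring `A` mapping to `𝓞_{ℂ_p}` (`p` is not a unit of `𝓞_{ℂ_p}`, `‖p‖ = p⁻¹ < 1`). -/
theorem natCast_prime_mem_maximalIdeal (p : ℕ) [Fact p.Prime] (A : Type) [CommRing A] [IsLocalRing A]
    [Algebra A 𝓞_ℂ_[p]] : (p : A) ∈ IsLocalRing.maximalIdeal A := by
  rw [IsLocalRing.mem_maximalIdeal, mem_nonunits_iff]
  intro hu
  have h := hu.map (algebraMap A 𝓞_ℂ_[p])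
  rw [map_natCast] at h
  exact Summit.Ventures.HodgeRepro.T3.R2Pinning.not_isUnit_natCast_prime p h

/-- The residue field of a local ring mapping to `𝓞_{ℂ_p}` has characteristic `p`. -/
theorem charP_residueField (p : ℕ) [Fact p.Prime] (A : Type) [CommRing A] [IsLocalRing A]
    [Algebra A 𝓞_ℂ_[p]] : CharP (IsLocalRing.ResidueField A) p := by
  have hp := natCast_prime_mem_maximalIdeal p A
  refine ⟨fun n => ?_⟩
  rw [← map_natCast (IsLocalRing.residue A) n]
  rw [IsLocalRing.residue_eq_zero_iff]
  constructor
  · intro hn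
    -- n ∈ 𝔪 ⇒ p ∣ n : the ideal 𝔪 ∩ ℤ is prime containing p
    by_contra hnd
    have hcop : Nat.Coprime p n := (Nat.Prime.coprime_iff_not_dvd Fact.out).2 hnd
    obtain ⟨a, b, hab⟩ := Nat.isCoprime_iff_coprime.2 hcop
    have : (1 : A) ∈ IsLocalRing.maximalIdeal A := by
      have h1 : ((a * p + b * n : ℤ) : A) = 1 := by exact_mod_cast congrArg (fun z : ℤ => (z : A)) hab
      rw [← h1]
      push_cast
      exact Ideal.add_mem _ (Ideal.mul_mem_left _ _ hp) (Ideal.mul_mem_left _ _ hn)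
    exact (IsLocalRing.maximalIdeal.isMaximal A).ne_top ((Ideal.eq_top_iff_one _).2 this)
  · rintro ⟨k, rfl⟩
    push_cast
    exact Ideal.mul_mem_right _ _ hp

/-- In characteristic `p`: `(1 + X)^{p^k} − 1 = X^{p^k}`. -/
theorem one_add_X_pow_sub_one (κ : Type) [CommRing κ] (p : ℕ) [Fact p.Prime] [CharP κ p] (k : ℕ) :
    ((1 + PowerSeries.X) ^ (p ^ k) - 1 : PowerSeries κ) = PowerSeries.X ^ (p ^ k) := by
  haveI := charP_powerSeries κ p
  rw [add_pow_char_pow, one_pow]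
  ring

/-- The Frobenius lines `T_i ↦ (1 + X)^{p^{k_i}} − 1` form an admissible substitution (zero constant coefficients). -/
theorem hasSubst_frobeniusLine (p : ℕ) (k : Fin d → ℕ) :
    MvPowerSeries.HasSubst (fun i : Fin d => (1 + PowerSeries.X) ^ p ^ k i - 1 : Fin d → PowerSeries R) :=
  MvPowerSeries.hasSubst_of_constantCoeff_zero (fun i => by simp [constantCoeff_X'])

/-! ## Part D — the `μ`-factoring over the discrete valuation ring -/

/-- **`μ`-factoring**: a non-zero `F ∈ A⟦T_1, …, T_d⟧` over a DVR `A` is `ϖ^μ • F′` with `F′ ≢ 0 (mod ϖ)`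
(`μ` = the minimum of the coefficient valuations; the coefficient attaining it becomes a unit). -/
theorem exists_smul_pow_irreducible_map_residue_ne_zero (A : Type) [CommRing A] [IsDomain A]
    [IsDiscreteValuationRing A] (F : MvPowerSeries (Fin d) A) (hF : F ≠ 0) :
    ∃ (ϖ : A) (μ : ℕ) (F' : MvPowerSeries (Fin d) A), Irreducible ϖ ∧ F = ϖ ^ μ • F' ∧
      MvPowerSeries.map (IsLocalRing.residue A) F' ≠ 0 := by
  obtain ⟨ϖ, hϖ⟩ := IsDiscreteValuationRing.exists_irreducible A
  -- the coefficient valuations and their minimum `μ`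
  let v : (Fin d →₀ ℕ) → ℕ∞ := fun m => IsDiscreteValuationRing.addVal A (MvPowerSeries.coeff m F)
  let S : Set ℕ := {n | ∃ m, v m = n}
  have hv_ne_top : ∀ m, MvPowerSeries.coeff m F ≠ 0 → v m ≠ ⊤ := fun m hm => by
    simpa [v, IsDiscreteValuationRing.addVal_eq_top_iff] using hm
  have hSne : S.Nonempty := by
    obtain ⟨m, hm⟩ : ∃ m, MvPowerSeries.coeff m F ≠ 0 := by
      by_contra h
      exact hF (MvPowerSeries.ext fun m => by
        rw [map_zero]
        by_contra h'
        exact h ⟨m, h'⟩)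
    obtain ⟨n, hn⟩ := ENat.ne_top_iff_exists.mp (hv_ne_top m hm)
    exact ⟨n, m, hn.symm⟩
  obtain ⟨m₀, hm₀⟩ : ∃ m, v m = ((sInf S : ℕ) : ℕ∞) := Nat.sInf_mem hSne
  have hdvd : ∀ m, ϖ ^ sInf S ∣ MvPowerSeries.coeff m F := by
    intro m
    rw [← IsDiscreteValuationRing.addVal_le_iff_dvd, hϖ.addVal_pow]
    by_cases h : MvPowerSeries.coeff m F = 0
    · rw [h, IsDiscreteValuationRing.addVal_zero]
      exact le_top
    · obtain ⟨n, hn⟩ := ENat.ne_top_iff_exists.mp (hv_ne_top m h)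
      have hnS : n ∈ S := ⟨m, hn.symm⟩
      change ((sInf S : ℕ) : ℕ∞) ≤ v m
      rw [← hn]
      exact_mod_cast Nat.sInf_le hnS
  choose F' hF' using hdvd
  refine ⟨ϖ, sInf S, F', hϖ, ?_, ?_⟩
  · exact MvPowerSeries.ext fun m => by rw [MvPowerSeries.coeff_smul, hF' m]; rfl
  · intro h0
    -- the coefficient `m₀` of `F′` is a unit, so its residue is non-zero
    have hres : IsLocalRing.residue A (F' m₀) = 0 := by
      have := congrArg (MvPowerSeries.coeff m₀) h0
      rwa [MvPowerSeries.coeff_map, map_zero] at this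
    rw [IsLocalRing.residue_eq_zero_iff, IsLocalRing.mem_maximalIdeal, mem_nonunits_iff] at hres
    apply hres
    rw [← IsDiscreteValuationRing.addVal_eq_zero_iff]
    have hval : v m₀ = ((sInf S : ℕ) : ℕ∞) := hm₀
    simp only [v] at hval
    rw [hF' m₀, IsDiscreteValuationRing.addVal_mul, hϖ.addVal_pow] at hval
    -- `(μ : ℕ∞) + x = μ` forces `x = 0`
    have hμ : ((sInf S : ℕ) : ℕ∞) ≠ ⊤ := ENat.coe_ne_top _
    exact WithTop.add_left_cancel hμ (hval.trans (add_zero _).symm)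

end FrobeniusLine

/-! ## The lemma K1a (statement VERBATIM from the skeleton, `Tier4/Line2/Skeleton.lean` v0.8 L274) -/

open FrobeniusLine in
/-- K1a — the Frobenius-line restriction of a non-zero series is non-zero for suitable exponents. -/
theorem exists_subst_frobenius_ne_zero (O : BranchCoefficients) {d : ℕ}
    (F : MvPowerSeries (Fin d) O.A) (hF : F ≠ 0) :
    ∃ k : Fin d → ℕ,
      MvPowerSeries.subst (fun i : Fin d => (1 + PowerSeries.X) ^ O.p ^ k i - 1 : Fin d → PowerSeries O.A) F ≠ 0 := by
  obtain ⟨ϖ, μ, F', hϖ, hFF', hF'⟩ := exists_smul_pow_irreducible_map_residue_ne_zero O.A F hF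
  haveI : CharP (IsLocalRing.ResidueField O.A) O.p := charP_residueField O.p O.A
  have hp2 : 2 ≤ O.p := O.hp.out.two_le
  obtain ⟨k, hk⟩ := exists_subst_X_pow_ne_zero O.p hp2 _ hF'
  refine ⟨k, fun h0 => hk ?_⟩
  have ha := hasSubst_frobeniusLine (R := O.A) O.p k
  -- reduction mod `ϖ` turns the Frobenius lines into the monomials `X^{p^{k_i}}`
  have key : MvPowerSeries.map (IsLocalRing.residue O.A)
      (MvPowerSeries.subst (fun i : Fin d => (1 + PowerSeries.X) ^ O.p ^ k i - 1 : Fin d → PowerSeries O.A) F') =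
      MvPowerSeries.subst (fun i => (PowerSeries.X : PowerSeries (IsLocalRing.ResidueField O.A)) ^ O.p ^ k i)
        (MvPowerSeries.map (IsLocalRing.residue O.A) F') := by
    rw [MvPowerSeries.map_subst ha]
    congr 1
    funext i
    rw [map_sub, map_pow, map_add, map_one]
    change (1 + PowerSeries.map (IsLocalRing.residue O.A) PowerSeries.X) ^ O.p ^ k i - 1 = _
    rw [PowerSeries.map_X, one_add_X_pow_sub_one]
  -- `ϖ^μ • subst F′ = 0` forces `subst F′ = 0` (the coefficients live in the domain `A`)
  have hG0 : MvPowerSeries.subst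
      (fun i : Fin d => (1 + PowerSeries.X) ^ O.p ^ k i - 1 : Fin d → PowerSeries O.A) F' = 0 := by
    refine MvPowerSeries.ext fun N => ?_
    have := congrArg (MvPowerSeries.coeff N) h0
    rw [hFF', MvPowerSeries.subst_smul ha, MvPowerSeries.coeff_smul, map_zero] at this
    rw [map_zero]
    exact (mul_eq_zero.mp this).resolve_left (pow_ne_zero _ hϖ.ne_zero)
  rw [← key, hG0, map_zero]

end Summit.Ventures.HodgeRepro.Tier4.Line2
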